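import Summits.QuantumAdvantage.QuantumAdvantage.Theses.LinnikCubicClassGroups
import Literature.NumberTheory.CubicFields.PeriodicChainCellsGrid

/-!
# Crux `LinnikCubicClassGroups.PureCubicClassGroupFBQP` (stmt-QuantumAdvantage-11544) — stub `stub_semCoords`

Line `arakelov-giant-step-cycle`, registered stub `stub_semCoords` (S5b-P5b-C) of skeleton v18: matching a perturbed circle
coordinate with its grid cell off the defect windows (pure real variables over `PeriodicChainCells*.lean`).
-/

set_option linter.dupNamespace false

namespace Summit.QuantumAdvantage.QuantumAdvantage.Theorems.LinnikCubicClassGroups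

open Literature.NumberTheory.CubicFields

/-- **S5b-P5b-C `stub_semCoords`**: on a periodic chain `G` (period `n₀`, `R`) with index function `idx` and `n₀`-periodic labels
`Lab`, a coordinate `u` within `(−ηd, Δ + ηd)` of the grid window `[(σ+j)Δ, (σ+j)Δ + Δ]` (`Δ = R/2^s`) whose `(η+ηd)`-enlargement
holds no breakpoint `G k + m/2^npp` is `η`-far from every breakpoint, and its cell `(Lab (idx u), ⌊(u − G (idx u)) 2^npp⌋)` is the
cell of the reduced grid point `((σ + j) mod 2^s)·Δ`. [Buchmann–Williams 1988 §3; Hallgren 2005 §4] -/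
theorem stub_semCoords :
    ∀ (G : ℤ → ℝ), StrictMono G → ∀ (n₀ : ℕ), 0 < n₀ → ∀ (R : ℝ), (∀ i, G (i + n₀) = G i + R) →
    ∀ (idx : ℝ → ℤ), (∀ x, G (idx x) ≤ x ∧ x < G (idx x + 1)) →
    ∀ (Lab : ℤ → ℕ × List ℤ), (∀ i j, Lab i = Lab j ↔ (n₀ : ℤ) ∣ i - j) →
    ∀ (npp s : ℕ) (η ηd : ℝ), 0 ≤ η → 0 ≤ ηd →
    ∀ (σ j : ℕ) (u : ℝ),
      (σ : ℝ) * (R / ((2 ^ s : ℕ) : ℝ)) + (j : ℝ) * (R / ((2 ^ s : ℕ) : ℝ)) - ηd < u →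
      u < (σ : ℝ) * (R / ((2 ^ s : ℕ) : ℝ)) + (j : ℝ) * (R / ((2 ^ s : ℕ) : ℝ)) + R / ((2 ^ s : ℕ) : ℝ) + ηd →
      (∀ (k : ℤ) (m : ℕ), (m : ℝ) / (2 : ℝ) ^ npp < G (k + 1) - G k →
        ¬ ((σ : ℝ) * (R / ((2 ^ s : ℕ) : ℝ)) + (j : ℝ) * (R / ((2 ^ s : ℕ) : ℝ)) - (η + ηd) ≤ G k + m / (2 : ℝ) ^ npp ∧
            G k + m / (2 : ℝ) ^ npp ≤
              (σ : ℝ) * (R / ((2 ^ s : ℕ) : ℝ)) + (j : ℝ) * (R / ((2 ^ s : ℕ) : ℝ)) + R / ((2 ^ s : ℕ) : ℝ) + (η + ηd))) →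
      (∀ (k : ℤ) (m : ℕ), (m : ℝ) / (2 : ℝ) ^ npp < G (k + 1) - G k → η < |u - (G k + m / (2 : ℝ) ^ npp)|) ∧
      (Lab (idx u), ⌊(u - G (idx u)) * (2 : ℝ) ^ npp⌋₊) =
        (Lab (idx ((((σ + j) % 2 ^ s : ℕ) : ℝ) * (R / ((2 ^ s : ℕ) : ℝ)))),
          ⌊(((((σ + j) % 2 ^ s : ℕ) : ℝ) * (R / ((2 ^ s : ℕ) : ℝ))) -
            G (idx ((((σ + j) % 2 ^ s : ℕ) : ℝ) * (R / ((2 ^ s : ℕ) : ℝ))))) * (2 : ℝ) ^ npp⌋₊) := by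
  intro G hG n₀ hn₀ R hper idx hidx Lab hLab npp s η ηd hη hηd σ j u hu1 hu2 hfree
  have hR : 0 < R := chain_period_pos hG hn₀ hper
  have h2s : (0 : ℝ) < ((2 ^ s : ℕ) : ℝ) := by positivity
  have hΔ : (0 : ℝ) ≤ R / ((2 ^ s : ℕ) : ℝ) := (div_pos hR h2s).le
  have hN : (0 : ℝ) < (2 : ℝ) ^ npp := by positivity
  refine ⟨?_, ?_⟩
  · -- (1) `u` is `η`-far from every breakpoint
    intro k m hgap
    have h := hfree k m hgap
    rw [lt_abs]
    by_cases hle : (σ : ℝ) * (R / ((2 ^ s : ℕ) : ℝ)) + (j : ℝ) * (R / ((2 ^ s : ℕ) : ℝ)) - (η + ηd) ≤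
        G k + m / (2 : ℝ) ^ npp
    · have h' : ¬ (G k + m / (2 : ℝ) ^ npp ≤
          (σ : ℝ) * (R / ((2 ^ s : ℕ) : ℝ)) + (j : ℝ) * (R / ((2 ^ s : ℕ) : ℝ)) + R / ((2 ^ s : ℕ) : ℝ) + (η + ηd)) :=
        fun h' => h ⟨hle, h'⟩
      have h'' := not_le.1 h'
      right; linarith
    · have h'' := not_le.1 hle
      left; linarith
  · -- (2) the cell of `u` is the cell of the reduced grid point
    -- first: `cell u = cell z`, `z = σΔ + jΔ`, by breakpoint-freeness of the interval between them
    have hcell : (Lab (idx u), ⌊(u - G (idx u)) * (2 : ℝ) ^ npp⌋₊) =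
        (Lab (idx ((σ : ℝ) * (R / ((2 ^ s : ℕ) : ℝ)) + (j : ℝ) * (R / ((2 ^ s : ℕ) : ℝ)))),
          ⌊(((σ : ℝ) * (R / ((2 ^ s : ℕ) : ℝ)) + (j : ℝ) * (R / ((2 ^ s : ℕ) : ℝ))) -
            G (idx ((σ : ℝ) * (R / ((2 ^ s : ℕ) : ℝ)) + (j : ℝ) * (R / ((2 ^ s : ℕ) : ℝ))))) * (2 : ℝ) ^ npp⌋₊) := by
      rcases le_total u ((σ : ℝ) * (R / ((2 ^ s : ℕ) : ℝ)) + (j : ℝ) * (R / ((2 ^ s : ℕ) : ℝ))) with huz | hzu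
      · obtain ⟨h1, h2⟩ := chain_cell_eq_of_no_breakpoint hG hidx hN huz
          (fun k m hgap hb => hfree k m hgap ⟨by linarith [hb.1], by linarith [hb.2]⟩)
        rw [h2, h1]
      · obtain ⟨h1, h2⟩ := chain_cell_eq_of_no_breakpoint hG hidx hN hzu
          (fun k m hgap hb => hfree k m hgap ⟨by linarith [hb.1], by linarith [hb.2]⟩)
        rw [← h2, ← h1]
    -- second: `z = ((σ+j) % 2^s)Δ + ((σ+j) / 2^s)·R`, and the cell function is `R`-periodic
    have hdm : ((2 ^ s : ℕ) : ℝ) * (((σ + j) / 2 ^ s : ℕ) : ℝ) + (((σ + j) % 2 ^ s : ℕ) : ℝ) = (σ : ℝ) + j := by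
      have h := Nat.div_add_mod (σ + j) (2 ^ s)
      exact_mod_cast h
    have hΔR : ((2 ^ s : ℕ) : ℝ) * (R / ((2 ^ s : ℕ) : ℝ)) = R := by
      field_simp
    have hzz' : (σ : ℝ) * (R / ((2 ^ s : ℕ) : ℝ)) + (j : ℝ) * (R / ((2 ^ s : ℕ) : ℝ)) =
        (((σ + j) % 2 ^ s : ℕ) : ℝ) * (R / ((2 ^ s : ℕ) : ℝ)) + ((((σ + j) / 2 ^ s : ℕ) : ℤ) : ℝ) * R := by
      have e : ((((σ + j) / 2 ^ s : ℕ) : ℤ) : ℝ) = (((σ + j) / 2 ^ s : ℕ) : ℝ) := Int.cast_natCast _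
      rw [e]
      calc (σ : ℝ) * (R / ((2 ^ s : ℕ) : ℝ)) + (j : ℝ) * (R / ((2 ^ s : ℕ) : ℝ))
          = ((σ : ℝ) + j) * (R / ((2 ^ s : ℕ) : ℝ)) := by ring
        _ = (((2 ^ s : ℕ) : ℝ) * (((σ + j) / 2 ^ s : ℕ) : ℝ) + (((σ + j) % 2 ^ s : ℕ) : ℝ)) *
              (R / ((2 ^ s : ℕ) : ℝ)) := by rw [hdm]
        _ = (((σ + j) % 2 ^ s : ℕ) : ℝ) * (R / ((2 ^ s : ℕ) : ℝ)) +
              (((σ + j) / 2 ^ s : ℕ) : ℝ) * (((2 ^ s : ℕ) : ℝ) * (R / ((2 ^ s : ℕ) : ℝ))) := by ring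
        _ = (((σ + j) % 2 ^ s : ℕ) : ℝ) * (R / ((2 ^ s : ℕ) : ℝ)) + (((σ + j) / 2 ^ s : ℕ) : ℝ) * R := by rw [hΔR]
    rw [hcell, hzz']
    exact cell_add_int_mul_period hG hn₀ hper hidx hLab _ _

end Summit.QuantumAdvantage.QuantumAdvantage.Theorems.LinnikCubicClassGroups
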